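import Literature.MathematicalPhysics.QuantumFieldTheory.BalabanImbrieJaffe1984to88.BIJ88Sect3Translations
import Literature.MathematicalPhysics.QuantumFieldTheory.BalabanImbrieJaffe1984to88.BIJ88ClocEstimatesTorus
import Literature.MathematicalPhysics.QuantumFieldTheory.BalabanImbrieJaffe1984to88.BIJ85CurlQsstar
import Literature.MathematicalPhysics.QuantumFieldTheory.BalabanImbrieJaffe1984to88.BIJ85Sigma421Torus
import Literature.MathematicalPhysics.QuantumFieldTheory.BalabanImbrieJaffe1984to88.BIJ88RT51Background42
import Literature.MathematicalPhysics.QuantumFieldTheory.BalabanImbrieJaffe1984to88.BIJ88Smooth43Axial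

/-!
# `BalabanImbrieJaffe1984to88.BIJ88SecondTranslation327Torus` — T. Bałaban, J. Imbrie, A. Jaffe, *Effective action and cluster properties of
the abelian Higgs model*, Commun. Math. Phys. **114** (1988) 257–315 [BalabanImbrieJaffe1988], Sect. 3 p. 269 [PDF 13]: **the second gauge-field
translation (3.27) and the background field (3.28) WITH THEIR CORRECTION `C^{(0)}_{loc}∂*Q^{e*}f` COMPOSED FROM THE OBJECTS OF RECORD on the torus**
— r18's typed translations `BIJ88Sect3Translations.Aprime327` / `u328` / `u1bg` take the bond function `corr = C^{(0)}_{loc}∂*Q^{e*}f` as DATA; here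
that data is given ITS BODY (`corr327`) from p09's localized covariance `C^{(0)}_{loc}` (2.9), p30's `∂*` and p31's `Q^{e*}` [I] (2.22) applied to
the field strength (3.26) of the block field, the typed displays are instantiated at it, and the p. 270 background `u₁` is identified with r18's
(4.2)-shape `backgroundU` and with p34's group-level (4.2)-background `bg42 1` carrying the printed correction factor.

statement-level skeleton of published theorems with citation tags; proofs where landed; nothing here is a claim about the Yang–Mills mass gap

PDF held: `paper:balaban1988-cmp114-bij-abelian-higgs-effective-action` (journal page = PDF page + 256); pp. 269–270 [PDF 13–14] re-read this session
from the text layer (`lit read … --pages 13-14`, files `p0013.txt`, `p0014.txt`).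

CITATION HEADER (lean-in-tree rule).  Part of the lit-balaban TYPED SKELETON (HOME `run/shared/lean/pub/lit-balaban/`), PHASE-2 proof seat p29
gen 33 (unit `lit-balaban-p29`; free-target protocol G.5-34(d): TAKING line HOME/STATUS.md 2026-08-23T11:44:22Z, owner r18 g27's split ruling
11:47:51Z «p29 holds (3.27)/(3.28) — the composition `corr327` WITH BODY + `Aprime327 … corr327` / `u328` / `u1bg` instances»; the SIZE of the
correction and (3.33) are p27 g39's complement, not claimed here).  Rows served: **C2.Eq3.27**, **C2.Eq3.28** of `HOME/lit-balaban-r18/ROWS-C2.md`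
(owner r18; the owed member named in `lit-balaban-r18/AUDIT-C2S14-DEF-g26.md`: «`corr327 := (Cloc P 0 R).mulVec (divergence-adjoint (Qestar f))` +
`Aprime327 … corr327` threaded into p34's `bg42`»); cells on C2.Eq3.26 / C2.Eq4.2.

THE PRINTED TEXT (verbatim, p. 269 [PDF 13]).  *"The quadratic form for the gauge field in Λ₁^{(0)**} is ⟨Λ₁^{(0)**}f^{(0)}, Λ₁^{(0)**}f^{(0)}⟩ =
⟨Λ₁^{(0)**}(∂A′ + L^{−2}Q^{e*}f), Λ₁^{(0)**}(∂A′ + L^{−2}Q^{e*}f)⟩, (3.25) where f(p) = (ie₀)^{−1}log v(p). (3.26)  A second translation is needed to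
remove the term linear in A′. We put A′ = A^{(0)} − Λ₄^{(0)*}L^{−2}C^{(0)}_{loc}∂*Q^{e*}f, (3.27) which does not precisely eliminate the linear term.
However, it is local, and away from ∂Λ₄^{(0)} the linear term is extremely small. … Let us write the background gauge field in Λ₃^{(0)*} in terms of
A^{(0)}. It is u = (Q^{s*}v) exp[ie₀(A^{(0)} − Λ₄^{(0)*}L^{−2}C^{(0)}_{loc}∂*Q^{e*}f)]. (3.28)"*  p. 270 [PDF 14]: *"For terms of zeroth order in θ₀A^{(0)}
we have a background gauge field u₁ = (Λ₁^{(0)*}Q^{s*}v)(Λ₆^{(0)*c}u^{(0)}) exp(ie₀Λ₄^{(0)*}L^{−2}C^{(0)}_{loc}∂*Q^{e*}f). Here u^{(0)} = exp(ie₀A^{(0)})."*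
(sign of the last exponential as (3.28)/(4.2): r18's transcription note T8).  p. 274 [PDF 18], (4.2): *"in Λ̄₆^{(k−1)*} it simplifies to u_k =
(Q^{s*}_ku) exp(−ie_kη𝒟_{k,loc}∂*Q^{e*}_kf^{(k)}), (4.2) where f^{(k)}(p) = (ie_k)^{−1}log u(p)."*

THE OBJECTS (tori of `Balaban1983to89.Setup`; fine level `j` = the unit lattice `T₁` of Sect. 3 (lattice constant `1`, as in r18's (3.25) `curl 1`),
block field `v` on the bonds of `T^{(j+1)}`, its field strength on the plaquettes of `T^{(j+1)}`):
* `f326 e₀ v` — (3.26) read as the REAL plaquette function `Re (ie₀)⁻¹log v(∂p′)`; for unimodular `v(∂p′)` this loses nothing: `(ie₀)⁻¹log z =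
  arg z/e₀` is real (p36's `fieldStrength_of_norm_one`; `ofReal_f326`, `ofReal_f326_cfg`);
* `corrOp j hd R g = C_{loc} *ᵥ ∂*(Q^{e*}g)` — THE OPERATOR `C^{(0)}_{loc}∂*Q^{e*}` with `C^{(0)}_{loc}` = p09's `BIJ88ClocEstimatesTorus.Cloc P j R`
  ((2.9), truncation radius `R`, print's `¼r(e₀)`), `∂*` = p30's `BIJ85Eq531Proof.plaqDiv 1` (the transpose of `LatticeFieldCalculus.curl 1`; its
  adjointness is p30's `sum_curl_mul`), `Q^{e*}` = the edge pull-back of p31's torus cell geometry `BIJ85CurlQsstar.torusEdgeCells P j hd` ([I] (2.22));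
* `corr327 hd R e₀ v = corrOp (f326 e₀ v)` — THE CORRECTION of (3.27)/(3.28) WITH BODY.

WHAT IS PROVED (kernel-checked, 0 `sorry`; definitions with bodies `f326`, `corrOp`, `corr327`, `D327`, `w327`; no `Prop`-valued fact, D-0026).
* §1 (3.26): `f326_eq_arg_div`, `ofReal_f326`, `ofReal_f326_cfg` (by p36's `fieldStrength_of_norm_one` — `(ie₀)⁻¹log z = arg z/e₀` for `|z| = 1` — the
  real reading IS the printed complex number for every `U(1)` block configuration), `f326_gaugeAct` ((3.26) is gauge invariant — r18's `fieldStrength_plaqVar_gaugeAct`),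
  `norm_phase` (the translation factors `e^{ie₀A}` are unimodular).
* §2 the operator and the correction: `corrOp_eq_mulVec`, linearity `corrOp_add` / `corrOp_smul` / `corrOp_zero` (p31's `cellsQstar_add/_smul`, p30's
  `plaqDiv_add/_smul`), `corr327_apply` (the printed triple composite unfolded), `corr327_eq_mulVec`, **`corr327_gaugeAct`** (the correction is a
  gauge-invariant function of the block configuration).
* §3 THE TYPED DISPLAYS AT THE COMPOSED CORRECTION (r18's decls BY NAME): **`aprime327_corr_of_mem`** / `_of_not_mem` ((3.27) inside / outside `Λ₄*`),
  `A0_eq_aprime327_add` ((3.27) solved for `A^{(0)}` — the form (3.33) uses), **`u328_corr_apply`**, **`u328_corr_eq_u324`** ((3.28) IS (3.24) with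
  `u′ = e^{ie₀A′}`, r18's `u328_eq_u324`), `norm_u328_corr` (`|u_b| = |(Q^{s*}v)_b|`), **`u1bg_eq_backgroundU`** (inside `Λ₁* ∩ Λ₆*` the p. 270 `u₁` IS
  r18's (4.2)-shape `backgroundU e₀ 1 (Q^{s*}v) (Λ₄*L⁻²corr)` — the `k = 1`, `η = 1` instance of (4.2)).
* §4 THE BRIDGE TO p34 (`k = 1`, fine lattice `T^{(0)}`): `D327` (the first-step instance of the operator slot `D` of p34's `BIJ88RT51Background42`,
  `D^{(0)}g = Λ₄*·L⁻²·C^{(0)}_{loc}∂*Q^{e*}(Re g)`), `D327_fieldStrength`, `w327` (the printed correction FACTOR `exp[−ie₀(D^{(0)}f)(b)] ∈ U(1)`),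
  **`gaugeInvariant_w327`** (p34's `gaugeInvariant_expCorr` — so p34's discharge theorems for (4.2)-shaped backgrounds apply to the first step),
  `qsstarGIter0_one`, **`u1bg_corr327_eq_cfg_bg42`**: `u₁(b) = cfg (bg42 1 w327 V)(b)` on `Λ₁* ∩ Λ₆*` — r18's typed first-step background with the
  composed correction IS p34's group-level (4.2)-background read in `ℂ` (p34's `cfg_bg42`).
HONEST SCOPE.  (i) Definitions, composition and dictionaries only: the SIZE `|corr(b)| ≤ C·sup|f|`, the locality of `corr` (p. 269 *"it is local"*,
finite range of `C^{(0)}_{loc}`) and (3.33) are NOT claimed here (p27 g39's complement over `corr327` by name); nor is the elimination of the linear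
term (*"does not precisely eliminate"*).  (ii) The truncation radius `R` of (2.8)/(2.9) is a free parameter (print: `¼r(e₀)`); `L` enters r18's displays
as a real parameter (print: the block size `P.L`).  (iii) (3.26) is read through r18's principal-branch `fieldStrength`; the real part is taken to
land in the real bond-function calculus — faithful for unimodular plaquette variables (§1), which is the model's case.  (iv) Torus (periodic b.c.),
`U(1)`, `d ≥ 2` (the edge geometry), standing range `j + 1 ≤ m + K` where p09's estimates are invoked downstream (not needed for the definitions).
(v) §4 is stated at `j = 0` because p34's `bg42` pulls back to the base torus `T^{(0)}`.  Imports Literature only; re-declares nothing (`∂*`, `Q^{e*}`,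
`C_{loc}`, `Aprime327`, `u328`, `u1bg`, `backgroundU`, `bg42` BY NAME); NOT summit progress; NOT continuum; NOT Clay.
-/

namespace Literature.MathematicalPhysics.QuantumFieldTheory.BalabanImbrieJaffe1984to88.BIJ88SecondTranslation327Torus

open Literature.MathematicalPhysics.QuantumFieldTheory.Balaban1983to89
open scoped BigOperators Matrix
open Complex
open LatticeFieldCalculus (curl)
open BIJ88ClocEstimatesTorus (Cloc)
open BIJ85CurlQsstar (torusEdgeCells)
open BIJ85Eq531Proof (plaqDiv plaqDiv_add plaqDiv_smul)
open BIJ85Sigma421Torus (cellsQstar_add cellsQstar_smul)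
open BIJ88Sect3Statements (U1 cfg toC fieldStrength plaqVar)
open BIJ88Sect3Translations (Aprime327 u328 u1bg phase u324 u328_eq_u324)
open BIJ88Sect4Statements (backgroundU)
open BIJ85BlockAveragesTorus (expU1 toC_expU1)
open BIJ85Eq453GaugeField (qsstarG qsstarGIter0 qsstarGIter0_succ qsstarGIter0_zero)
open BIJ88RT51Background42 (bg42 cfg_bg42 gaugeInvariant_expCorr)
open BIJ88BlockGauge417 (fieldStrength_plaqVar_gaugeAct)
open BIJ88Smooth43Axial (fieldStrength_of_norm_one norm_plaqVar_cfg)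

noncomputable section

/-! ## §1  (3.26): the field strength of the block field — the real reading, its faithfulness, its gauge invariance -/

section Corr

variable {P : Params} {j : ℕ}

/-- **(3.26)** p. 269 [PDF 13], verbatim: *"where f(p) = (ie₀)⁻¹log v(p). (3.26)"* — the field strength of the block field `v` on the plaquettes
of the block lattice `T^{(j+1)}` (r18's principal-branch `fieldStrength` of the plaquette variable `plaqVar v p′`), read as the REAL plaquette
function it is for a `U(1)`-valued `v` (`log` of a unit complex number is purely imaginary): its real part.
[cite: BalabanImbrieJaffe1988, (3.26) p.269] -/
def f326 (e₀ : ℝ) (v : PBond P (j + 1) → ℂ) : Balaban1983to89.Plaq P (j + 1) → ℝ :=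
  fun p' => (fieldStrength e₀ (plaqVar v p')).re

/-- (3.26) unfolded. [cite: BalabanImbrieJaffe1988, (3.26) p.269] -/
theorem f326_apply (e₀ : ℝ) (v : PBond P (j + 1) → ℂ) (p' : Balaban1983to89.Plaq P (j + 1)) :
    f326 e₀ v p' = (fieldStrength e₀ (plaqVar v p')).re := rfl


/-- the real reading of (3.26) is faithful for unimodular block fields: `f(p′) = arg v(∂p′)/e₀` (p36's `fieldStrength_of_norm_one`: for `|z| = 1`
the principal-branch `(ie₀)⁻¹log z = arg z/e₀` is REAL) … [cite: BalabanImbrieJaffe1988, (3.26) p.269] -/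
theorem f326_eq_arg_div (e₀ : ℝ) (v : PBond P (j + 1) → ℂ) {p' : Balaban1983to89.Plaq P (j + 1)} (hv : ‖plaqVar v p'‖ = 1) :
    f326 e₀ v p' = arg (plaqVar v p') / e₀ := by
  rw [f326_apply, fieldStrength_of_norm_one e₀ hv, ofReal_re]

/-- … and `(f(p′) : ℂ) = (ie₀)⁻¹log v(p′)` — nothing is lost by taking the real part. [cite: BalabanImbrieJaffe1988, (3.26) p.269] -/
theorem ofReal_f326 (e₀ : ℝ) (v : PBond P (j + 1) → ℂ) {p' : Balaban1983to89.Plaq P (j + 1)} (hv : ‖plaqVar v p'‖ = 1) :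
    ((f326 e₀ v p' : ℝ) : ℂ) = fieldStrength e₀ (plaqVar v p') := by
  rw [f326_eq_arg_div e₀ v hv, fieldStrength_of_norm_one e₀ hv]

/-- in the model (`v = cfg V`, a `U(1)` block configuration) every plaquette variable is unimodular, so `(f : ℂ) = (ie₀)⁻¹log v(p′)` throughout.
[cite: BalabanImbrieJaffe1988, (3.26) p.269] -/
theorem ofReal_f326_cfg (e₀ : ℝ) (V : GaugeField P (j + 1) U1) (p' : Balaban1983to89.Plaq P (j + 1)) :
    ((f326 e₀ (cfg V) p' : ℝ) : ℂ) = fieldStrength e₀ (plaqVar (cfg V) p') :=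
  ofReal_f326 e₀ (cfg V) (norm_plaqVar_cfg V p')

/-- kernel: the phase factors `e^{ie₀A_b}` of (3.24)/(3.28) are unimodular. [cite: BalabanImbrieJaffe1988, (3.24) p.269] -/
theorem norm_phase (e₀ : ℝ) (A : PBond P j → ℝ) (b : PBond P j) : ‖phase e₀ A b‖ = 1 := by
  rw [phase, norm_exp, mul_comm, re_ofReal_mul, I_re, mul_zero, Real.exp_zero]

/-- (3.26) is gauge invariant: `f` depends on `v` only through the plaquette variables `v(∂p′)` (r18's `fieldStrength_plaqVar_gaugeAct`).
[cite: BalabanImbrieJaffe1988, (3.26) p.269] -/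
theorem f326_gaugeAct (e₀ : ℝ) (g : GaugeTransf P (j + 1) U1) (V : GaugeField P (j + 1) U1) :
    f326 e₀ (cfg (GaugeField.gaugeAct g V)) = f326 e₀ (cfg V) := by
  funext p'
  rw [f326_apply, f326_apply, fieldStrength_plaqVar_gaugeAct]

/-! ## §2  The operator `C^{(0)}_{loc}∂*Q^{e*}` of (3.27)/(3.28) COMPOSED from the objects of record, and the correction WITH BODY -/

variable [DecidableEq (PBond P j)]

variable (j) in
/-- **THE OPERATOR `C^{(0)}_{loc}∂*Q^{e*}` of (3.27)/(3.28)** p. 269 [PDF 13] — plaquette functions of the block lattice `T^{(j+1)}` ↦ bond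
functions of `T^{(j)}` — COMPOSED FROM THE OBJECTS OF RECORD on the torus: `Q^{e*}` = the edge pull-back [I] (2.22) of the torus cell
geometry (p31's `BIJ85CurlQsstar.torusEdgeCells … .Qstar`), `∂*` = the adjoint of the unit-lattice curl (p30's `BIJ85Eq531Proof.plaqDiv 1`;
unit lattice `T₁` of Sect. 3, lattice constant `1` as in r18's (3.25) `curl 1`), `C^{(0)}_{loc}` = the localized gauge-field covariance (2.9)
(p09's `BIJ88ClocEstimatesTorus.Cloc P j R`, truncation radius `R` — print's `¼r(e₀)`).  `(C_{loc}∂*Q^{e*}g)(b) = Σ_{b′} C_{loc}(b,b′)(∂*Q^{e*}g)(b′)`.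
[cite: BalabanImbrieJaffe1988, (3.27) p.269] -/
def corrOp (hd : 2 ≤ P.d) (R : ℝ) (g : Balaban1983to89.Plaq P (j + 1) → ℝ) : PBond P j → ℝ :=
  fun b => ∑ b' : PBond P j, Cloc P j R b b' * plaqDiv 1 ((torusEdgeCells P j hd).Qstar g) b'

/-- kernel: `C_{loc}∂*Q^{e*}g = C_{loc} *ᵥ (∂*(Q^{e*}g))` as a matrix–vector product. [cite: BalabanImbrieJaffe1988, (3.27) p.269] -/
theorem corrOp_eq_mulVec (hd : 2 ≤ P.d) (R : ℝ) (g : Balaban1983to89.Plaq P (j + 1) → ℝ) :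
    corrOp j hd R g = Cloc P j R *ᵥ plaqDiv 1 ((torusEdgeCells P j hd).Qstar g) := rfl

/-- `C^{(0)}_{loc}∂*Q^{e*}` is additive (a composite of three linear maps). [cite: BalabanImbrieJaffe1988, (3.27) p.269] -/
theorem corrOp_add (hd : 2 ≤ P.d) (R : ℝ) (g h : Balaban1983to89.Plaq P (j + 1) → ℝ) :
    corrOp j hd R (g + h) = corrOp j hd R g + corrOp j hd R h := by
  have hq : (torusEdgeCells P j hd).Qstar (g + h) =
      fun p => (torusEdgeCells P j hd).Qstar g p + (torusEdgeCells P j hd).Qstar h p := by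
    rw [cellsQstar_add]; rfl
  funext b
  simp only [corrOp, Pi.add_apply, hq, plaqDiv_add, mul_add, Finset.sum_add_distrib]

/-- `C^{(0)}_{loc}∂*Q^{e*}` is homogeneous. [cite: BalabanImbrieJaffe1988, (3.27) p.269] -/
theorem corrOp_smul (hd : 2 ≤ P.d) (R a : ℝ) (g : Balaban1983to89.Plaq P (j + 1) → ℝ) :
    corrOp j hd R (a • g) = a • corrOp j hd R g := by
  have hq : (torusEdgeCells P j hd).Qstar (a • g) = fun p => a * (torusEdgeCells P j hd).Qstar g p := by
    rw [cellsQstar_smul]; rfl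
  funext b
  simp only [corrOp, Pi.smul_apply, hq, plaqDiv_smul, smul_eq_mul, Finset.mul_sum]
  refine Finset.sum_congr rfl fun b' _ => ?_
  ring

/-- `C^{(0)}_{loc}∂*Q^{e*}0 = 0`. [cite: BalabanImbrieJaffe1988, (3.27) p.269] -/
theorem corrOp_zero (hd : 2 ≤ P.d) (R : ℝ) : corrOp j hd R 0 = 0 := by
  have h := corrOp_smul (j := j) hd R 0 0
  rwa [zero_smul, zero_smul] at h

/-- **THE CORRECTION OF (3.27)/(3.28) WITH BODY**: `corr = C^{(0)}_{loc}∂*Q^{e*}f` for the field strength `f` (3.26) of the block field `v` —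
the bond function entering r18's typed translations `Aprime327`, `u328`, `u1bg` as the data `corr`. [cite: BalabanImbrieJaffe1988, (3.27) p.269] -/
def corr327 (hd : 2 ≤ P.d) (R e₀ : ℝ) (v : PBond P (j + 1) → ℂ) : PBond P j → ℝ :=
  corrOp j hd R (f326 e₀ v)

/-- (3.27)'s correction unfolded to the printed triple composite: `(C_{loc}∂*Q^{e*}f)(b) = Σ_{b′} C^{(0)}_{loc}(b,b′)·(∂*(Q^{e*}f))(b′)`.
[cite: BalabanImbrieJaffe1988, (3.27) p.269] -/
theorem corr327_apply (hd : 2 ≤ P.d) (R e₀ : ℝ) (v : PBond P (j + 1) → ℂ) (b : PBond P j) :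
    corr327 hd R e₀ v b = ∑ b' : PBond P j, Cloc P j R b b' * plaqDiv 1 ((torusEdgeCells P j hd).Qstar (f326 e₀ v)) b' := rfl

/-- `corr = C_{loc} *ᵥ ∂*(Q^{e*}f)`. [cite: BalabanImbrieJaffe1988, (3.27) p.269] -/
theorem corr327_eq_mulVec (hd : 2 ≤ P.d) (R e₀ : ℝ) (v : PBond P (j + 1) → ℂ) :
    corr327 hd R e₀ v = Cloc P j R *ᵥ plaqDiv 1 ((torusEdgeCells P j hd).Qstar (f326 e₀ v)) := rfl

/-- **the correction `C^{(0)}_{loc}∂*Q^{e*}f` is a gauge-invariant function of the block field `v`** (p. 277: the background gauge transformations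
act through `A^{(0)}` / `λ` only). [cite: BalabanImbrieJaffe1988, (3.27) p.269] -/
theorem corr327_gaugeAct (hd : 2 ≤ P.d) (R e₀ : ℝ) (g : GaugeTransf P (j + 1) U1) (V : GaugeField P (j + 1) U1) :
    corr327 hd R e₀ (cfg (GaugeField.gaugeAct g V)) = corr327 hd R e₀ (cfg V) := by
  rw [corr327, corr327, f326_gaugeAct]

/-! ## §3  (3.27), (3.28) and the p. 270 display `u₁` AT the composed correction (r18's typed translations consumed BY NAME) -/

/-- **(3.27)** p. 269, verbatim: *"A second translation is needed to remove the term linear in A′. We put A′ = A^{(0)} − Λ₄^{(0)*}L^{−2}C^{(0)}_{loc}∂*Q^{e*}f,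
(3.27)"* — r18's `Aprime327` AT the composed correction, inside `Λ₄*`: `A′_b = A^{(0)}_b − L⁻²(C^{(0)}_{loc}∂*Q^{e*}f)(b)`.
[cite: BalabanImbrieJaffe1988, (3.27) p.269] -/
theorem aprime327_corr_of_mem (hd : 2 ≤ P.d) (R e₀ L : ℝ) (v : PBond P (j + 1) → ℂ) {Λ₄star : Finset (PBond P j)}
    (A0 : PBond P j → ℝ) {b : PBond P j} (hb : b ∈ Λ₄star) :
    Aprime327 Λ₄star L A0 (corr327 hd R e₀ v) b = A0 b - L ^ (-(2 : ℤ)) * corr327 hd R e₀ v b := by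
  simp [Aprime327, hb]

/-- (3.27) outside `Λ₄*`: no second translation, `A′_b = A^{(0)}_b` (*"the prefactor … indicates that what follows is present only for b ∈ Λ₄*"*).
[cite: BalabanImbrieJaffe1988, (3.27) p.269] -/
theorem aprime327_corr_of_not_mem (hd : 2 ≤ P.d) (R e₀ L : ℝ) (v : PBond P (j + 1) → ℂ) {Λ₄star : Finset (PBond P j)}
    (A0 : PBond P j → ℝ) {b : PBond P j} (hb : b ∉ Λ₄star) :
    Aprime327 Λ₄star L A0 (corr327 hd R e₀ v) b = A0 b := by
  simp [Aprime327, hb]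

/-- (3.27) solved for the new variable: `A^{(0)} = A′ + Λ₄*L⁻²C^{(0)}_{loc}∂*Q^{e*}f` (the form in which (3.33) uses it). [cite: BalabanImbrieJaffe1988, (3.27) p.269] -/
theorem A0_eq_aprime327_add (L : ℝ) (Λ₄star : Finset (PBond P j)) (A0 corr : PBond P j → ℝ) (b : PBond P j) :
    A0 b = Aprime327 Λ₄star L A0 corr b + (if b ∈ Λ₄star then L ^ (-(2 : ℤ)) * corr b else 0) := by
  unfold Aprime327
  split_ifs <;> ring

/-- **(3.28)** p. 269, verbatim: *"u = (Q^{s*}v) exp[ie₀(A^{(0)} − Λ₄^{(0)*}L^{−2}C^{(0)}_{loc}∂*Q^{e*}f)]. (3.28)"* — r18's `u328` AT the composed correction: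
`u_b = (Q^{s*}v)_b·e^{ie₀A′_b}` with `A′` = (3.27). [cite: BalabanImbrieJaffe1988, (3.28) p.269] -/
theorem u328_corr_apply (hd : 2 ≤ P.d) (R e₀ L : ℝ) (v : PBond P (j + 1) → ℂ) (w : PBond P j → ℂ) (Λ₄star : Finset (PBond P j))
    (A0 : PBond P j → ℝ) (b : PBond P j) :
    u328 w e₀ Λ₄star L A0 (corr327 hd R e₀ v) b = w b * phase e₀ (Aprime327 Λ₄star L A0 (corr327 hd R e₀ v)) b := rfl

/-- (3.28) IS the translation (3.24) with `u′ = e^{ie₀A′}` on `Λ₁*` (r18's `u328_eq_u324`, here at the composed correction).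
[cite: BalabanImbrieJaffe1988, (3.28) p.269] -/
theorem u328_corr_eq_u324 (hd : 2 ≤ P.d) (R e₀ L : ℝ) (v : PBond P (j + 1) → ℂ) {Λ₁star : Finset (PBond P j)} (w : PBond P j → ℂ)
    (Λ₄star : Finset (PBond P j)) (A0 : PBond P j → ℝ) {b : PBond P j} (hb : b ∈ Λ₁star) :
    u328 w e₀ Λ₄star L A0 (corr327 hd R e₀ v) b = u324 Λ₁star (phase e₀ (Aprime327 Λ₄star L A0 (corr327 hd R e₀ v))) w b :=
  u328_eq_u324 w e₀ Λ₄star L A0 _ hb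

/-- the translation (3.28) is by a unimodular factor: `|u_b| = |(Q^{s*}v)_b|`. [cite: BalabanImbrieJaffe1988, (3.28) p.269] -/
theorem norm_u328_corr (hd : 2 ≤ P.d) (R e₀ L : ℝ) (v : PBond P (j + 1) → ℂ) (w : PBond P j → ℂ) (Λ₄star : Finset (PBond P j))
    (A0 : PBond P j → ℝ) (b : PBond P j) :
    ‖u328 w e₀ Λ₄star L A0 (corr327 hd R e₀ v) b‖ = ‖w b‖ := by
  rw [u328_corr_apply, norm_mul, norm_phase, mul_one]

/-- **the p. 270 display** (background gauge field of the first step, zeroth order in `θ₀A^{(0)}`), verbatim: *"u₁ = (Λ₁^{(0)*}Q^{s*}v)(Λ₆^{(0)*c}u^{(0)})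
exp(ie₀Λ₄^{(0)*}L^{−2}C^{(0)}_{loc}∂*Q^{e*}f)"* (sign as (3.28)/(4.2), r18's transcription note T8) — INSIDE `Λ₁* ∩ Λ₆*` it is r18's (4.2)-shape
`backgroundU e₀ 1 (Q^{s*}v) (Λ₄*L⁻²corr)`: `u₁ = (Q^{s*}v)·exp[−ie₀(Λ₄*L⁻²corr)]` — the `k = 1`, `η = 1` instance of (4.2) *"in Λ̄₆* it simplifies to
u_k = (Q^{s*}_ku)exp(−ie_kη𝒟_{k,loc}∂*Q^{e*}_kf^{(k)})"*. [cite: BalabanImbrieJaffe1988, (3.28) p.270] -/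
theorem u1bg_eq_backgroundU {Λ₁star Λ₄star Λ₆star : Finset (PBond P j)} (w : PBond P j → ℂ) (e₀ L : ℝ) (A0 corr : PBond P j → ℝ)
    {b : PBond P j} (hb₁ : b ∈ Λ₁star) (hb₆ : b ∈ Λ₆star) :
    u1bg Λ₁star Λ₄star Λ₆star w e₀ L A0 corr b =
      backgroundU e₀ 1 w (fun b => if b ∈ Λ₄star then L ^ (-(2 : ℤ)) * corr b else 0) b := by
  by_cases h₄ : b ∈ Λ₄star <;> simp [u1bg, backgroundU, hb₁, hb₆, h₄]

end Corr

/-! ## §4  The bridge to p34's group-level (4.2)-background `bg42` at the first step (`k = 1`, fine lattice `T^{(0)}`) -/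

section Bridge

variable {P : Params} [DecidableEq (PBond P 0)]

/-- the first-step instance of the operator slot `D` of p34's `BIJ88RT51Background42` (`w(u)(b) = exp[−ie_kη·(D f^{(k)}(u))(b)]`, `D = 𝒟_{k,loc}∂*Q^{e*}_k`
in (4.2)): `D^{(0)} g = Λ₄*·L⁻²·C^{(0)}_{loc}∂*Q^{e*}(Re g)` on complex plaquette functions `g` of `T^{(1)}` (the field strengths are real; `Re` is the
reading of (3.26)). [cite: BalabanImbrieJaffe1988, (4.2) p.274] -/
def D327 (hd : 2 ≤ P.d) (R L : ℝ) (Λ₄star : Finset (PBond P 0)) (g : Balaban1983to89.Plaq P 1 → ℂ) : PBond P 0 → ℝ :=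
  fun b => if b ∈ Λ₄star then L ^ (-(2 : ℤ)) * corrOp 0 hd R (fun p => (g p).re) b else 0

/-- kernel: at the field strengths of `v = cfg V`, `D^{(0)}f = Λ₄*L⁻²·corr327`. [cite: BalabanImbrieJaffe1988, (4.2) p.274] -/
theorem D327_fieldStrength (hd : 2 ≤ P.d) (R L e₀ : ℝ) (Λ₄star : Finset (PBond P 0)) (V : GaugeField P 1 U1) (b : PBond P 0) :
    D327 hd R L Λ₄star (fun p => fieldStrength e₀ (plaqVar (cfg V) p)) b =
      if b ∈ Λ₄star then L ^ (-(2 : ℤ)) * corr327 hd R e₀ (cfg V) b else 0 := rfl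

/-- the printed correction FACTOR `exp[−ie₀(Λ₄*L⁻²C^{(0)}_{loc}∂*Q^{e*}f)(b)]` as a `U(1)`-valued function of the block configuration (p34's `expCorr`
shape with `D = D^{(0)}`, `e_k = e₀`, `η = 1`). [cite: BalabanImbrieJaffe1988, (4.2) p.274] -/
def w327 (hd : 2 ≤ P.d) (R L e₀ : ℝ) (Λ₄star : Finset (PBond P 0)) (U : GaugeField P 1 U1) : GaugeField P 0 U1 :=
  fun b => expU1 (-(e₀ * 1 * D327 hd R L Λ₄star (fun p => fieldStrength e₀ (plaqVar (cfg U) p)) b))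

/-- the correction factor is a GAUGE-INVARIANT function of the block configuration (p34's `gaugeInvariant_expCorr` with `D = D^{(0)}`) — so every
kernel hypothesis p34 discharges for (4.2)-shaped backgrounds holds for the first-step background. [cite: BalabanImbrieJaffe1988, (4.17) p.277] -/
theorem gaugeInvariant_w327 (hd : 2 ≤ P.d) (R L e₀ : ℝ) (Λ₄star : Finset (PBond P 0)) :
    GaugeField.GaugeInvariant (w327 hd R L e₀ Λ₄star) :=
  gaugeInvariant_expCorr e₀ 1 (D327 hd R L Λ₄star)

omit [DecidableEq (PBond P 0)] in
/-- kernel: `Q^{s*}_1 = Q^{s*}` (p31's base-`0` composite at one step). [cite: BalabanImbrieJaffe1985, (2.24) p.305] -/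
theorem qsstarGIter0_one (V : GaugeField P 1 U1) : qsstarGIter0 1 V = qsstarG V := by
  rw [qsstarGIter0_succ, qsstarGIter0_zero]

/-- **THE BRIDGE r18 (3.28)/p. 270 ↔ p34 (4.2)**: inside `Λ₁* ∩ Λ₆*`, r18's typed first-step background `u₁` — with the block field entered as
`Q^{s*}v = cfg (Q^{s*}V)` (p31's group-level pull-back `qsstarG`) and the correction COMPOSED as `corr327` — IS, read in `ℂ`, p34's group-level
(4.2)-background `bg42 1` with the printed correction factor `w327`: `u₁(b) = cfg (bg42 1 w327 V)(b)`. [cite: BalabanImbrieJaffe1988, (4.2) p.274] -/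
theorem u1bg_corr327_eq_cfg_bg42 (hd : 2 ≤ P.d) (R L e₀ : ℝ) {Λ₁star Λ₄star Λ₆star : Finset (PBond P 0)} (A0 : PBond P 0 → ℝ)
    (V : GaugeField P 1 U1) {b : PBond P 0} (hb₁ : b ∈ Λ₁star) (hb₆ : b ∈ Λ₆star) :
    u1bg Λ₁star Λ₄star Λ₆star (cfg (qsstarG V)) e₀ L A0 (corr327 hd R e₀ (cfg V)) b =
      cfg (bg42 1 (w327 hd R L e₀ Λ₄star) V) b := by
  have h := cfg_bg42 (k := 1) e₀ 1 (fun U => D327 hd R L Λ₄star (fun p => fieldStrength e₀ (plaqVar (cfg U) p))) V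
  have hw : (fun (U : GaugeField P 1 U1) (b : PBond P 0) =>
      expU1 (-(e₀ * 1 * D327 hd R L Λ₄star (fun p => fieldStrength e₀ (plaqVar (cfg U) p)) b))) = w327 hd R L e₀ Λ₄star := rfl
  rw [hw] at h
  rw [h, qsstarGIter0_one, u1bg_eq_backgroundU _ _ _ _ _ hb₁ hb₆]
  rfl

end Bridge

end

end Literature.MathematicalPhysics.QuantumFieldTheory.BalabanImbrieJaffe1984to88.BIJ88SecondTranslation327Torus
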